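import Summits.SmoothPoincare4.SmoothPoincare4.Theses.EntropyRung
import Summits.SmoothPoincare4.SmoothPoincare4.Theorems.SubcylindricalExistence.Negative.ConstTest
import Summits.SmoothPoincare4.SmoothPoincare4.Theorems.SubcylindricalExistence.Negative.Window
import Summits.SmoothPoincare4.SmoothPoincare4.Theorems.SubcylindricalExistence.Negative.Logic
import Literature.Geometry.Lorentzian.ConformalChangeFour
import HarnessLib
import HarnessLib.Audit

/-!
# Line `green-blowup-conformal-entropy` for crux `EntropyRung.SubcylindricalExistence`
# (stmt-SmoothPoincare4-10871, "ENT")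

Planner skeleton (crux-plan, round 1) of the idea card
`Cruxes/SubcylindricalExistence/Ideas/green-blowup-conformal-entropy.md`, sharpened by the panel
notes TRIAGE-r1-{1,2,3}.md.

ENT: every closed smooth `M ≃ₕ S⁴` carries a Riemannian metric with `R > 0` and
`ν > ν_cyl = log 2 + ½ log π − 3/2` (the crux's unfolded `𝒲`-clause, gap `δ > 0`, all scales `τ`).

THE LINE. Replace the unknown "a metric" by "a conformal class and a point": for `(g, p)` let
`G` be the Green function of the conformal Laplacian `L_g = −6Δ_g + R_g` at `p` (GREEN DATA:
`G` smooth and positive on `M ∖ {p}`, `R_g G − 6 □_g G = 0` there, `G → +∞` at `p`). The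
blow-up `h = G² g` on `M ∖ {p}` is complete, SCALAR-FLAT and asymptotically Euclidean (Schoen 1984,
Lee–Parker 1987 §6), and its entropy clause — Perelman's `𝒲` of `h` over test functions
`u = (4πτ)⁻² w²`, `w ∈ C^∞(M)` vanishing near `p`, written on `M` against `dV_g`
(`dV_h = G⁴ dV_g`, `|∇w|²_h = G⁻²|∇w|²_g`, `R_h ≡ 0`) — depends only on `([g], p)`.
  `stub_blowupExistence` (the transferred crux `C⁺ = ENT_G`, SPC4-hard, HARDEST): some `([g],p)`
on every homotopy 4-sphere has a blow-up clearing `ν_cyl` (on `S⁴`: round class, any `p`,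
`h` = flat `ℝ⁴`, `ν = 0`, margin `0.2345` by Gross's sharp Euclidean log-Sobolev inequality).
  `stub_conformalLaplacianSolve` (L): Green data force `λ₁(L_g) > 0`, so `L_g ψ = F` has a smooth
POSITIVE solution for every smooth `F > 0` (Bôcher + first eigenfunction + Fredholm; Lee–Parker §2–3).
  `stub_roundEntropyBound` (M/L, = the route's RoundBound, provable WITHOUT Perelman monotonicity
by the CD(3,4) entropy–energy inequality, shared with line `curvature-dimension-entropy-floor`):
`Ric ≥ 3g`, `Vol ≥ 8π²/3` on a closed connected 4-manifold ⇒ the clause holds at level `log 6 − 2`.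
  `stub_conformalGluing` (XL, the analytic heart — Kobayashi 1987 / Schoen 1984 gluing done for
`μ` instead of the Yamabe quotient): INSIDE the conformal class `[g]` take
`ψ_ε = L_g⁻¹(12χβ_ε³ + η_ε)` (`β_ε` the standard bubble at `p` in `g`-normal coordinates,
`χ` a cut-off, `η_ε ↓ 0`): `L_g ψ_ε > 0` everywhere, `ψ_ε² g` is a round `S⁴(½)` off a tiny
region carrying `ε²c²h`; a three-regime blow-up analysis of minimisers (`τ ≳ 1`: round limit
+ RoundBound; `τ ∼ ε²`: limit `c²h` + the blow-up clause; in between and `τ → 0`: Euclidean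
limit; `τ → ∞`: `R > 0` and a uniform spectral gap), with the uniform Yamabe–Sobolev inequality
of the class (`Y(M,[g]) > 0`) excluding concentration and pigeon-holed annuli in the AE end making
the localisation loss `o(1)`, gives `ν(ψ_ε² g) ≥ min(log 6 − 2, ν_cyl + δ) − o(1) > ν_cyl`
(`log 6 − 2 > ν_cyl`: `Negative.nuCyl_lt_nuRound`, landed p69811). Output: a smooth `ψ > 0` with
`L_g ψ > 0` and the clause OF `ψ² g` WRITTEN ON `g` (`dV' = ψ⁴dV`, `R' = ψ⁻³L_gψ`,
`|∇f|²' = ψ⁻²|∇f|²`).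
  `stub_conformalRealisation` (M): realise `ψ² g` as a smooth Riemannian metric with Levi-Civita
connection and transport the clause (`scalarCurvature_conformal_sq_four`,
`riemannianMeasure_of_conformal` of `Lorentzian/ConformalChangeFour.lean` are in the tree; the
`gradSq` law and the `withDensity` bookkeeping are not).
  `SubcylindricalExistence_of`: the crux BY NAME from the five stubs (pure logic, below).

DISPROOF USED (payload `disproof_path` = cdisprove Disproof.lean v6; the file itself is not
readable from this jail, its landed content is imported above): `Negative/Logic.lean`
(`subcylindricalExistence_iff_spc4`: ENT ⇔ SPC4 modulo RUNG — honoured: all SPC4-hard content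
sits in ONE named stub, `stub_blowupExistence`, the declared transfer; every other stub is a
theorem-shaped statement true on every `M`); `Negative/ConstTest.lean`
(`subcylindricalWitness_totalScalar_sq`: any witness has `(∫R)² ≥ 128π^{5/2}e^{1/2}e^{δ}·Vol` —
the output of `stub_conformalRealisation ∘ stub_conformalGluing` is `97%`-Yamabe-extremal, consistent:
`ψ_ε²g → round S⁴(½)` has `(∫R)²/Vol → 384π²`); `Negative/Window.lean` (`nuCyl_lt_nuRound`,
`margin_gt`: the round cap clears the threshold by `> 0.026`, which is exactly the room
`stub_conformalGluing` spends on its `o(1)`). No `_false_without_` theorem or `-- Targets` stub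
kill bears on these stubs (none landed for 10871; `ledger negatives` = 0).
-/

noncomputable section

open scoped Manifold ContDiff Topology ENNReal NNReal ContinuousMap
open Set Filter MeasureTheory
open Literature.Geometry.Lorentzian

namespace Summit.SmoothPoincare4.SmoothPoincare4.Cruxes.SubcylindricalExistence.GreenBlowupConformalEntropy

/-! ## Stub A — `ENT_G`, the transferred crux (HARDEST; SPC4-hard)

GREEN DATA for `(g, p, G)`: `G` smooth on `M ∖ {p}`, positive there, `R_g G − 6 □_g G = 0` there
(`□_g = tr_g Hess = Δ_g`, so this is `L_g G = 0` with `L_g = −6Δ_g + R_g`, the conformal Laplacian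
in dimension 4), and `G → +∞` at `p`; by Bôcher `G = a·Γ_p + smooth`, `a > 0`, and `h = G² g` is
the scalar-flat asymptotically Euclidean blow-up of `([g], p)` (Schoen 1984 §1; Lee–Parker 1987
§6, Thm 6.5). BLOW-UP CLAUSE at level `c` with gap `δ`: for all `τ > 0` and all smooth `w`
vanishing near `p` with `∫ (4πτ)⁻² w² G⁴ dV_g = 1`,
`c + δ ≤ ∫ [4τ G⁻²|∇w|²_g − w² log w² − 4w²] (4πτ)⁻² G⁴ dV_g` — this is literally
`𝒲(h, f, τ) ≥ c + δ` for `u_h = (4πτ)⁻² e^{−f} = (4πτ)⁻² w²` (the term `τ R_h u_h` vanishes).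
It is an invariant of `([g], p)`: for `g̃ = φ² g`, `G̃ = φ(p)⁻¹ φ⁻¹ G` and `G̃² g̃ = φ(p)⁻² G² g`
(triage r1-1/2/3 re-derived), and `𝒲` is scale-invariant.

**Statement (ENT_G).** Every closed smooth homotopy 4-sphere carries `(g, p, G)` with Green data
whose blow-up clause holds at level `ν_cyl`. TRUE on `S⁴` (round `g`, any `p`: `G` = the
stereographic conformal factor, `h` = flat `ℝ⁴`, `μ(ℝ⁴, τ) = 0` for all `τ` by Gross's sharp
log-Sobolev inequality, `δ = 3/2 − log 2 − ½ log π ≈ 0.2345`; tree vocabulary for that instance: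
`roundMetric`, `stereoFactor`, `stereoMetric_val_eq_smul` of `Riemannian/StereographicConformal.lean`).
With `stub_conformalGluing` it implies ENT, hence (RUNG) SPC4: SPC4-hard, plausibly STRICTLY
stronger than ENT (no converse is claimed). Why it might fail: an exotic `Σ` would have
`ν(h) ≤ ν_cyl` for EVERY scalar-flat AE blow-up — the honest bet of the card. -/
theorem stub_blowupExistence :
    ∀ (M : Type) [TopologicalSpace M] [T2Space M] [SecondCountableTopology M]
      [ChartedSpace (EuclideanSpace ℝ (Fin 4)) M] [IsManifold (𝓡 4) ∞ M] [CompactSpace M]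
      [T3Space M] [MeasurableSpace M] [BorelSpace M],
      M ≃ₕ Metric.sphere (0 : EuclideanSpace ℝ (Fin 5)) 1 →
      ∃ g : PseudoRiemannianMetric (𝓡 4) ∞ (EuclideanSpace ℝ (Fin 4)) (TangentSpace (𝓡 4) : M → Type _),
      ∃ _ : g.HasLeviCivita, ∃ hg : g.IsRiemannian, ∃ p : M, ∃ G : M → ℝ,
        (ContMDiffOn (𝓡 4) 𝓘(ℝ, ℝ) ∞ G {p}ᶜ ∧ (∀ x, x ≠ p → 0 < G x) ∧
          (∀ x, x ≠ p → g.scalarCurvature x * G x - 6 * g.dalembertian G x = 0) ∧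
          Tendsto G (𝓝[≠] p) atTop) ∧
        ∃ δ : ℝ, 0 < δ ∧ ∀ τ : ℝ, 0 < τ → ∀ w : M → ℝ, ContMDiff (𝓡 4) 𝓘(ℝ, ℝ) ∞ w →
          w =ᶠ[𝓝 p] 0 →
          ∫ x, (4 * Real.pi * τ) ^ (-(4 : ℝ) / 2) * (w x) ^ 2 * (G x) ^ 4
              ∂(riemannianMeasure (g.toContMDiffRiemannianMetric hg)) = 1 →
            Real.log 2 + Real.log Real.pi / 2 - 3 / 2 + δ ≤
              ∫ x, (4 * τ * ((G x)⁻¹ ^ 2 * g.gradSq w x) - (w x) ^ 2 * Real.log ((w x) ^ 2)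
                  - 4 * (w x) ^ 2) * ((4 * Real.pi * τ) ^ (-(4 : ℝ) / 2) * (G x) ^ 4)
                ∂(riemannianMeasure (g.toContMDiffRiemannianMetric hg)) := by
  sorry

/-! ## Stub B — the round cap clears the threshold (RoundBound, without Perelman monotonicity)

**Statement.** On a closed connected smooth 4-manifold, a Riemannian metric with `Ric ≥ 3 g` and
`Vol ≥ 8π²/3 = Vol(S⁴(1))` satisfies the crux's clause at level `log 6 − 2 = ν(S⁴_round)` for
EVERY `τ > 0` (no gap). Proof route (triage r1-2/r1-3 derivations, verified to `10⁻¹⁵`): the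
CD(3,4) entropy–energy inequality `Ent_m(w²) ≤ 2 log(1 + E/3)` for the normalised volume measure
(Bakry–Bolley–Gentil arXiv:1412.5165 §4 (4.1); Bakry–Gentil–Ledoux 2014 §6.7) and the Legendre
identity `𝒲 = τ∫Ru + 4τE − Ent + log V − 2 log(4πτ) − 4`, `R ≥ 12`, give
`μ(g,τ) ≥ log V − 2 log(2π/3) − 2` for all `τ` (the `τ`-dependence cancels exactly on `(0,1/6]`,
strict surplus beyond), `= log 6 − 2` at `V = 8π²/3`. Equivalently: Cao–Hamilton–Ilmanen 2004
Thm 3.4 (`ν(S⁴) = log Θ(S⁴) = log(6/e²)`) via Perelman's monotonicity on the shrinking sphere.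
`[ConnectedSpace]` is load-bearing (`S⁴ ⊔ ℂP²` would fail). This is the route's support statement
RoundBound and the `V = V_S` case of `EntropyVolumeComparison` of line
`curvature-dimension-entropy-floor` — whichever lands first serves both. Used by
`stub_conformalGluing` on the round limit of the glued metrics (after scaling:
`wEntropy_constSmul`, `riemVolume_constSmul`, `scalarCurvatureWith_constSmul`, `gradSq_constSmul`). -/
theorem stub_roundEntropyBound :
    ∀ (N : Type) [TopologicalSpace N] [T2Space N] [SecondCountableTopology N]
      [ChartedSpace (EuclideanSpace ℝ (Fin 4)) N] [IsManifold (𝓡 4) ∞ N] [CompactSpace N]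
      [ConnectedSpace N] [T3Space N] [MeasurableSpace N] [BorelSpace N]
      (g : PseudoRiemannianMetric (𝓡 4) ∞ (EuclideanSpace ℝ (Fin 4)) (TangentSpace (𝓡 4) : N → Type _))
      [g.HasLeviCivita] (hg : g.IsRiemannian),
      (∀ (x : N) (X : TangentSpace (𝓡 4) x), 3 * g.val x X X ≤ g.ricci x X X) →
      ENNReal.ofReal (8 * Real.pi ^ 2 / 3) ≤ riemannianMeasure (g.toContMDiffRiemannianMetric hg) univ →
      ∀ τ : ℝ, 0 < τ → ∀ f : N → ℝ, ContMDiff (𝓡 4) 𝓘(ℝ, ℝ) ∞ f →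
        ∫ x, (4 * Real.pi * τ) ^ (-(4 : ℝ) / 2) * Real.exp (-f x)
            ∂(riemannianMeasure (g.toContMDiffRiemannianMetric hg)) = 1 →
          Real.log 6 - 2 ≤
            ∫ x, (τ * (g.scalarCurvature x + g.gradSq f x) + f x - 4) *
                ((4 * Real.pi * τ) ^ (-(4 : ℝ) / 2) * Real.exp (-f x))
              ∂(riemannianMeasure (g.toContMDiffRiemannianMetric hg)) := by
  sorry

/-! ## Stub C — Green data make the conformal Laplacian positively invertible

**Statement.** For Green data `(g, p, G)` on a closed smooth homotopy 4-sphere (connectedness is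
load-bearing) and every smooth `F > 0` there is a smooth `ψ > 0` with `L_g ψ = R_g ψ − 6 □_g ψ = F`.
Why true: `λ₁(L_g) > 0` — write `G = v φ₁` with `φ₁ > 0` the first eigenfunction; at an interior
minimum of `v` on `M ∖ {p}` (it exists: `v → +∞` at `p`) `λ₁ v φ₁ = 6 φ₁ Δv ≥ 0`, so `λ₁ ≥ 0`, and
`λ₁ = 0` would make `v` a bounded-below `φ₁²`-harmonic function with a non-removable isolated
singularity and zero flux, impossible by Bôcher (equivalently: integrate `φ₁ L_g G` by parts on
`M ∖ B_ε(p)` with `G ∼ a r⁻²`, `a > 0`); then `L_g` is a self-adjoint elliptic isomorphism on `C^∞`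
(Fredholm + regularity) and `ψ = L_g⁻¹ F > 0` by the same minimum argument. Size L (the tree's
elliptic theory on closed manifolds is thin: `SobolevClosedManifold`, `GreenIdentity`,
`SchrodingerGroundState`). Sources: Lee–Parker 1987 §2–3, Kazdan–Warner 1975, Gilbarg–Serrin. -/
theorem stub_conformalLaplacianSolve :
    ∀ (M : Type) [TopologicalSpace M] [T2Space M] [SecondCountableTopology M]
      [ChartedSpace (EuclideanSpace ℝ (Fin 4)) M] [IsManifold (𝓡 4) ∞ M] [CompactSpace M]
      [T3Space M] [MeasurableSpace M] [BorelSpace M],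
      M ≃ₕ Metric.sphere (0 : EuclideanSpace ℝ (Fin 5)) 1 →
      ∀ (g : PseudoRiemannianMetric (𝓡 4) ∞ (EuclideanSpace ℝ (Fin 4)) (TangentSpace (𝓡 4) : M → Type _))
        [g.HasLeviCivita], g.IsRiemannian → ∀ (p : M) (G : M → ℝ),
        (ContMDiffOn (𝓡 4) 𝓘(ℝ, ℝ) ∞ G {p}ᶜ ∧ (∀ x, x ≠ p → 0 < G x) ∧
          (∀ x, x ≠ p → g.scalarCurvature x * G x - 6 * g.dalembertian G x = 0) ∧
          Tendsto G (𝓝[≠] p) atTop) →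
        ∀ F : M → ℝ, ContMDiff (𝓡 4) 𝓘(ℝ, ℝ) ∞ F → (∀ x, 0 < F x) →
          ∃ ψ : M → ℝ, ContMDiff (𝓡 4) 𝓘(ℝ, ℝ) ∞ ψ ∧ (∀ x, 0 < ψ x) ∧
            ∀ x, g.scalarCurvature x * ψ x - 6 * g.dalembertian ψ x = F x := by
  sorry

/-! ## Stub D — conformal Kobayashi–Schoen gluing for `μ` (the analytic heart; XL)

**Statement.** Assume RoundBound (the statement of `stub_roundEntropyBound`, by text). Let
`(g, p, G)` be Green data on a closed smooth homotopy 4-sphere whose blow-up clause holds at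
level `ν_cyl` (gap `δ`), and assume `L_g` is positively invertible (the statement of
`stub_conformalLaplacianSolve` for this `g`). Then there is a smooth `ψ > 0` on `M` with
`L_g ψ = R_g ψ − 6 □_g ψ > 0` everywhere such that the clause of the conformal metric `ψ² g`,
written on `g` (`dV' = ψ⁴ dV_g`, `R' = ψ⁻³ L_g ψ`, `|∇f|²' = ψ⁻² |∇f|²_g`), holds at level
`ν_cyl` with some gap `δ' > 0`.
Intended proof: `ψ = ψ_ε := L_g⁻¹(12 χ β_ε³ + η_ε)` for small `ε` (module docstring): in the
class `[g]`, `R' = ψ⁻³ L_g ψ > 0`; `ψ_ε² g` converges to the round `S⁴(½)` away from a point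
and `ε⁻²ψ_ε² g → c² G² g` on compacts of `M ∖ {p}`; minimisers of `𝒲` exist on the closed `M`
(Rothaus) and cannot concentrate below their scale (uniform Yamabe–Sobolev constant of the class);
at scales `τ ≳ 1` they see the round sphere (RoundBound, level `log 6 − 2 > ν_cyl`,
`Negative.nuCyl_lt_nuRound`), at `τ ≲ ε²` the blow-up `h` (hypothesis, level `ν_cyl + δ`) or
flat space (level `0`), in between flat `ℝ⁴`; straddling test functions are cut along an annulus
of the AE end carrying `o(1)` of their mass and Dirichlet energy (pigeon-hole over `|log ε|`
dyadic annuli), and the mixing entropy `−Σ mᵢ log mᵢ ≥ 0` pays for the renormalisation, so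
`ν(ψ_ε² g) ≥ min(log 6 − 2, ν_cyl + δ) − o(1)`; `τ → ∞` is handled by `R' > 0` plus a spectral
gap uniform in `ε`. Quantitative form asked by triage r1-1 (F1): the loss is
`O(ρ²|A| + ρ) + O(1/|log(ρ/ε)|)` for junction radius `ρ`, so any `ε ≪ ρ ≪ 1` works against the
margin `min(0.026, δ)`. No literature does this for `μ` (Kobayashi 1987 Math. Ann. 279 and
Schoen 1984 do it for the Yamabe quotient; Yu Li arXiv:1603.05336 §3 treats `μ` on AE ends);
a `stub-false` here (gluing loses a definite amount `≥ 0.026`) kills the LINE, not the crux. -/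
theorem stub_conformalGluing :
    (∀ (N : Type) [TopologicalSpace N] [T2Space N] [SecondCountableTopology N]
      [ChartedSpace (EuclideanSpace ℝ (Fin 4)) N] [IsManifold (𝓡 4) ∞ N] [CompactSpace N]
      [ConnectedSpace N] [T3Space N] [MeasurableSpace N] [BorelSpace N]
      (g : PseudoRiemannianMetric (𝓡 4) ∞ (EuclideanSpace ℝ (Fin 4)) (TangentSpace (𝓡 4) : N → Type _))
      [g.HasLeviCivita] (hg : g.IsRiemannian),
      (∀ (x : N) (X : TangentSpace (𝓡 4) x), 3 * g.val x X X ≤ g.ricci x X X) →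
      ENNReal.ofReal (8 * Real.pi ^ 2 / 3) ≤ riemannianMeasure (g.toContMDiffRiemannianMetric hg) univ →
      ∀ τ : ℝ, 0 < τ → ∀ f : N → ℝ, ContMDiff (𝓡 4) 𝓘(ℝ, ℝ) ∞ f →
        ∫ x, (4 * Real.pi * τ) ^ (-(4 : ℝ) / 2) * Real.exp (-f x)
            ∂(riemannianMeasure (g.toContMDiffRiemannianMetric hg)) = 1 →
          Real.log 6 - 2 ≤
            ∫ x, (τ * (g.scalarCurvature x + g.gradSq f x) + f x - 4) *
                ((4 * Real.pi * τ) ^ (-(4 : ℝ) / 2) * Real.exp (-f x))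
              ∂(riemannianMeasure (g.toContMDiffRiemannianMetric hg))) →
    ∀ (M : Type) [TopologicalSpace M] [T2Space M] [SecondCountableTopology M]
      [ChartedSpace (EuclideanSpace ℝ (Fin 4)) M] [IsManifold (𝓡 4) ∞ M] [CompactSpace M]
      [T3Space M] [MeasurableSpace M] [BorelSpace M],
      M ≃ₕ Metric.sphere (0 : EuclideanSpace ℝ (Fin 5)) 1 →
      ∀ (g : PseudoRiemannianMetric (𝓡 4) ∞ (EuclideanSpace ℝ (Fin 4)) (TangentSpace (𝓡 4) : M → Type _))
        [g.HasLeviCivita] (hg : g.IsRiemannian) (p : M) (G : M → ℝ),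
        (ContMDiffOn (𝓡 4) 𝓘(ℝ, ℝ) ∞ G {p}ᶜ ∧ (∀ x, x ≠ p → 0 < G x) ∧
          (∀ x, x ≠ p → g.scalarCurvature x * G x - 6 * g.dalembertian G x = 0) ∧
          Tendsto G (𝓝[≠] p) atTop) →
        (∃ δ : ℝ, 0 < δ ∧ ∀ τ : ℝ, 0 < τ → ∀ w : M → ℝ, ContMDiff (𝓡 4) 𝓘(ℝ, ℝ) ∞ w →
          w =ᶠ[𝓝 p] 0 →
          ∫ x, (4 * Real.pi * τ) ^ (-(4 : ℝ) / 2) * (w x) ^ 2 * (G x) ^ 4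
              ∂(riemannianMeasure (g.toContMDiffRiemannianMetric hg)) = 1 →
            Real.log 2 + Real.log Real.pi / 2 - 3 / 2 + δ ≤
              ∫ x, (4 * τ * ((G x)⁻¹ ^ 2 * g.gradSq w x) - (w x) ^ 2 * Real.log ((w x) ^ 2)
                  - 4 * (w x) ^ 2) * ((4 * Real.pi * τ) ^ (-(4 : ℝ) / 2) * (G x) ^ 4)
                ∂(riemannianMeasure (g.toContMDiffRiemannianMetric hg))) →
        (∀ F : M → ℝ, ContMDiff (𝓡 4) 𝓘(ℝ, ℝ) ∞ F → (∀ x, 0 < F x) →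
          ∃ ψ : M → ℝ, ContMDiff (𝓡 4) 𝓘(ℝ, ℝ) ∞ ψ ∧ (∀ x, 0 < ψ x) ∧
            ∀ x, g.scalarCurvature x * ψ x - 6 * g.dalembertian ψ x = F x) →
        ∃ ψ : M → ℝ, ContMDiff (𝓡 4) 𝓘(ℝ, ℝ) ∞ ψ ∧ (∀ x, 0 < ψ x) ∧
          (∀ x, 0 < g.scalarCurvature x * ψ x - 6 * g.dalembertian ψ x) ∧
          ∃ δ : ℝ, 0 < δ ∧ ∀ τ : ℝ, 0 < τ → ∀ f : M → ℝ, ContMDiff (𝓡 4) 𝓘(ℝ, ℝ) ∞ f →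
            ∫ x, (4 * Real.pi * τ) ^ (-(4 : ℝ) / 2) * Real.exp (-f x) * ψ x ^ 4
                ∂(riemannianMeasure (g.toContMDiffRiemannianMetric hg)) = 1 →
              Real.log 2 + Real.log Real.pi / 2 - 3 / 2 + δ ≤
                ∫ x, (τ * ((ψ x ^ 3)⁻¹ * (g.scalarCurvature x * ψ x - 6 * g.dalembertian ψ x) +
                      (ψ x ^ 2)⁻¹ * g.gradSq f x) + f x - 4) *
                    ((4 * Real.pi * τ) ^ (-(4 : ℝ) / 2) * Real.exp (-f x)) * ψ x ^ 4
                  ∂(riemannianMeasure (g.toContMDiffRiemannianMetric hg)) := by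
  sorry

/-! ## Stub E — realising `ψ² g` and transporting the clause (conformal law for `𝒲`)

**Statement.** For a smooth Riemannian `g` (with Levi-Civita connection) on a closed smooth
4-manifold and a smooth `ψ > 0` with `L_g ψ > 0`: if the clause of `ψ² g` written on `g` holds at
level `c` (gap `δ`), there is a smooth Riemannian metric `g'` with Levi-Civita connection,
`g' = ψ² g` pointwise, `R_{g'} > 0` everywhere, satisfying the crux's own clause at level `c`.
Why true / proof plan: `g'_x = ψ(x)² g_x` is symmetric, positive definite and smooth as a section
(`ContMDiff.smul_section`, cf. `InitialDataSet.conformal` in `Lorentzian/PositiveMassConformal.lean`);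
`g'.HasLeviCivita` from `PseudoRiemannianMetric.hasLeviCivita`; `R_{g'} = ψ⁻³(R_g ψ − 6□_g ψ)`
is `scalarCurvature_conformal_sq_four` and `dV_{g'} = ψ⁴ dV_g` is `riemannianMeasure_of_conformal`
(`Lorentzian/ConformalChangeFour.lean`, both proved); `g'.gradSq f = ψ⁻² g.gradSq f`
(`♯_{ψ²g} = ψ⁻² ♯_g`, `sharp_comp_toBilinForm_of_conformal`) is the one missing law; then both
integrals are rewritten by `integral_withDensity_eq_integral_smul` (unconditional in the
integrand). Size M. Sources: Aubin 1982 Ch. 6 §6.3–6.4; Besse 1987 Thm 1.159. -/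
theorem stub_conformalRealisation :
    ∀ (M : Type) [TopologicalSpace M] [T2Space M] [SecondCountableTopology M]
      [ChartedSpace (EuclideanSpace ℝ (Fin 4)) M] [IsManifold (𝓡 4) ∞ M] [CompactSpace M]
      [T3Space M] [MeasurableSpace M] [BorelSpace M]
      (g : PseudoRiemannianMetric (𝓡 4) ∞ (EuclideanSpace ℝ (Fin 4)) (TangentSpace (𝓡 4) : M → Type _))
      [g.HasLeviCivita] (hg : g.IsRiemannian) (ψ : M → ℝ),
      ContMDiff (𝓡 4) 𝓘(ℝ, ℝ) ∞ ψ → (∀ x, 0 < ψ x) →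
      (∀ x, 0 < g.scalarCurvature x * ψ x - 6 * g.dalembertian ψ x) →
      ∀ c : ℝ,
        (∃ δ : ℝ, 0 < δ ∧ ∀ τ : ℝ, 0 < τ → ∀ f : M → ℝ, ContMDiff (𝓡 4) 𝓘(ℝ, ℝ) ∞ f →
          ∫ x, (4 * Real.pi * τ) ^ (-(4 : ℝ) / 2) * Real.exp (-f x) * ψ x ^ 4
              ∂(riemannianMeasure (g.toContMDiffRiemannianMetric hg)) = 1 →
            c + δ ≤
              ∫ x, (τ * ((ψ x ^ 3)⁻¹ * (g.scalarCurvature x * ψ x - 6 * g.dalembertian ψ x) +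
                    (ψ x ^ 2)⁻¹ * g.gradSq f x) + f x - 4) *
                  ((4 * Real.pi * τ) ^ (-(4 : ℝ) / 2) * Real.exp (-f x)) * ψ x ^ 4
                ∂(riemannianMeasure (g.toContMDiffRiemannianMetric hg))) →
        ∃ g' : PseudoRiemannianMetric (𝓡 4) ∞ (EuclideanSpace ℝ (Fin 4)) (TangentSpace (𝓡 4) : M → Type _),
        ∃ _ : g'.HasLeviCivita, ∃ hg' : g'.IsRiemannian,
          (∀ (x : M) (v w : TangentSpace (𝓡 4) x), g'.val x v w = ψ x ^ 2 * g.val x v w) ∧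
          (∀ x : M, 0 < g'.scalarCurvature x) ∧
          ∃ δ : ℝ, 0 < δ ∧ ∀ τ : ℝ, 0 < τ → ∀ f : M → ℝ, ContMDiff (𝓡 4) 𝓘(ℝ, ℝ) ∞ f →
            ∫ x, (4 * Real.pi * τ) ^ (-(4 : ℝ) / 2) * Real.exp (-f x)
                ∂(riemannianMeasure (g'.toContMDiffRiemannianMetric hg')) = 1 →
              c + δ ≤
                ∫ x, (τ * (g'.scalarCurvature x + g'.gradSq f x) + f x - 4) *
                    ((4 * Real.pi * τ) ^ (-(4 : ℝ) / 2) * Real.exp (-f x))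
                  ∂(riemannianMeasure (g'.toContMDiffRiemannianMetric hg')) := by
  sorry

/-! ## Composition — ENT from the five stubs (pure logic, sorry-free) -/

/-- **ENT from the line.** `SubcylindricalExistence` (stmt-SmoothPoincare4-10871) BY NAME: for
`M ≃ₕ S⁴`, Stub A gives a conformal class, a point and its Green blow-up clearing `ν_cyl`; Stub C
inverts `L_g` positively; Stub D (fed RoundBound = Stub B by statement) produces a conformal factor
`ψ > 0` with `L_g ψ > 0` whose metric `ψ² g` clears `ν_cyl`, written on `g`; Stub E realises `ψ² g`
as a Riemannian metric with Levi-Civita connection, `R > 0` and the crux's own clause. -/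
theorem SubcylindricalExistence_of :
    _root_.Summit.SmoothPoincare4.SmoothPoincare4.Theses.EntropyRung.SubcylindricalExistence := by
  intro M _ _ _ _ _ _ _ _ _ e
  -- Stub A: a conformal class, a point, its Green function, and the super-cylindrical blow-up
  obtain ⟨g, hLC, hg, p, G, hGreen, hBlow⟩ := stub_blowupExistence M e
  -- Stub C: the conformal Laplacian of `g` is positively invertible
  have hSolve := stub_conformalLaplacianSolve M e g hg p G hGreen
  -- Stub D (with Stub B as its RoundBound input): the glued conformal factor `ψ`
  obtain ⟨ψ, hψ, hψpos, hLψ, hW⟩ :=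
    stub_conformalGluing stub_roundEntropyBound M e g hg p G hGreen hBlow hSolve
  -- Stub E: realise `ψ² g` and read off `R > 0` and the crux's clause at level `ν_cyl`
  obtain ⟨g', hLC', hg', -, hR', hν'⟩ :=
    stub_conformalRealisation M g hg ψ hψ hψpos hLψ (Real.log 2 + Real.log Real.pi / 2 - 3 / 2) hW
  exact ⟨g', hLC', hg', hR', hν'⟩

/-! ## Sanity pins against the landed Negative lemmas (no new content) -/

/-- The round cap clears the cylinder threshold with room `> 0.026` — the budget of the `o(1)` in
`stub_conformalGluing` (Negative/Window.lean, p69811). -/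
example : (0.026 : ℝ) < (Real.log 6 - 2) - (Real.log 2 + Real.log Real.pi / 2 - 3 / 2) :=
  Summit.SmoothPoincare4.Cruxes.SubcylindricalExistence.Negative.margin_gt

/-- ENT ⇔ SPC4 modulo RUNG and the transported round witness (Negative/Logic.lean): the line's only
SPC4-hard content is `stub_blowupExistence`. -/
example (hRung : _root_.Summit.SmoothPoincare4.SmoothPoincare4.Theses.EntropyRung.SubcylindricalRecognition)
    (h : ¬ _root_.SmoothPoincare4) :
    ¬ _root_.Summit.SmoothPoincare4.SmoothPoincare4.Theses.EntropyRung.SubcylindricalExistence :=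
  Summit.SmoothPoincare4.Cruxes.SubcylindricalExistence.Negative.not_subcylindricalExistence_of_not_spc4
    hRung h

end Summit.SmoothPoincare4.SmoothPoincare4.Cruxes.SubcylindricalExistence.GreenBlowupConformalEntropy

end
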